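import Summits.BirchSwinnertonDyer.BirchSwinnertonDyer.Theses.SignedBalanceX9
import Summits.BirchSwinnertonDyer.BirchSwinnertonDyer.Theorems.SignedBalanceX9Assembly
import HarnessLib

/-!
# Route `SignedBalanceX9` — `AssemblyViaUpper` (the one-sided separation), kernel-checked

`Summit.BirchSwinnertonDyer.BirchSwinnertonDyer.Theses.SignedBalanceX9.AssemblyViaUpper` :=
`FourTermDefectUpperX9 → AnalyticMuZeroX9 → TwistedAnalyticMuZeroX9 → PublishedInputsX9 →
IntegralMainConjectureOnClassX9` is PROVED.  At an X9 pair BCS 2025 Thm 1.1.2 (a) (first conjunct of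
`PublishedInputsX9`) gives `ch X = (g)`, `ι g = p^k · L_p(f, α)` with `k ∈ ℤ`.  SIGN: a `p`-adic unit
coefficient of `L_p` forces `0 ≤ k` since `ι g ∈ ℤ_p⟦T⟧` (`defect_nonneg_of_unit_coeff`).  The supply
(α′) gives a BCS-admissible `(d_K, d_F)` whose three twists carry unit coefficients; they are X9 again
(`X9.classX9_of_smul_eq_quadraticTwist`; `d_K d_F` square-free because the primes of `d_F` split in `K`),
so each carries a BCS datum `k_i ≥ 0`; ONE-SIDED CONSERVATION (`FourTermDefectUpperX9`, the Euler-system half of the integral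
product main conjecture over `K`, specialised to the cyclotomic line): `k + k₁ + k₂ + k₃ ≤ 0`; hence `k = 0`
(the lower half `0 ≤ Σ k_i` — BCS25 Prop. 5.2.1's direction — is supplied for free by the sign lemma): the exact generator, i.e. `IntegralMainConjectureOnClassX9` at the pair.

THEOREMS ONLY (no definition, no named fact, no `sorry`); nothing booked — the balance, the two analytic
`μ = 0` supplies and the published inputs are hypotheses; no summit or leaf is proved (ideator seat
bsd-idea-2 g2, LINE 5).
-/

set_option linter.dupNamespace false
set_option autoImplicit false

noncomputable section

open scoped Classical

open WeierstrassCurve Literature.NumberTheory.EllipticCurves Literature.NumberTheory.EllipticCurves.ModularForms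
  Summit.BirchSwinnertonDyer.BirchSwinnertonDyer.Rank1Residual

open Summit.BirchSwinnertonDyer.BirchSwinnertonDyer.Theses.SignedBalanceX9
  (FourTermDefectUpperX9 AnalyticMuZeroX9 TwistedAnalyticMuZeroX9 PublishedInputsX9 AssemblyViaUpper)

namespace Summit.BirchSwinnertonDyer.BirchSwinnertonDyer.Rank1Residual

namespace SignedBalanceUpper

/-! ### The sign lemma, square-freeness of `d_K d_F`, twist data, and the Assembly -/

/-- **The glue `Assembly`, proved.** At an X9 pair BCS (a) gives `ch X = (g)`, `ι g = p^k L_p`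
(`k ∈ ℤ`); (α′) supplies an admissible `(d_K, d_F)` whose three twists carry unit coefficients; each twist
is X9 again (twist stability; `d_K d_F` is square-free by admissibility) and carries its own BCS datum
`k_i`; the four-term Balance gives `k + k₁ + k₂ + k₃ = 0`; the sign lemma gives `0 ≤ k` (analytic
`μ = 0` at `W`) and `0 ≤ k_i` (unit coefficients of the twists); hence `k = 0`: the exact generator. -/
theorem signedBalanceX9_assemblyViaUpper : AssemblyViaUpper := by
  intro hUp hMu hTw hPub W _ _ p _ κ γ N _ f hX9 hκ hγ hγ' hf D
  obtain ⟨hBCSa, -, -, -, -, -, -, -⟩ := hPub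
  obtain ⟨hX, g, k, hchar, hιg⟩ :=
    hBCSa W p κ γ f hX9.2.1 hX9.2.2.1 hX9.2.2.2.1 hX9.2.2.2.2.1 hκ hγ hγ' hf D
  suffices hk : k = 0 by
    subst hk
    exact ⟨hX, g, hchar, by simpa using hιg⟩
  have hk0 : 0 ≤ k := SignedBalance.defect_nonneg_of_unit_coeff (hMu W p f hX9 hf) hιg
  obtain ⟨dK, dF, hadm, hUK, hUF, hUKF⟩ := hTw W p hX9
  have hp5 : 5 ≤ p := hX9.2.1
  have hpK : ¬ (p : ℤ) ∣ dK := hadm.2.2.1.1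
  have hpF : ¬ (p : ℤ) ∣ dF := hadm.2.2.2.2.1.1
  have hsqK : Squarefree dK := hadm.1.2.1
  have hsqF : Squarefree dF := hadm.2.2.2.1.2.1
  have hsqKF : Squarefree (dK * dF) :=
    SignedBalance.squarefree_mul_of_admissible hsqK hsqF fun ℓ hℓ hℓF => (hadm.2.2.2.2.2.1 ℓ hℓ hℓF).1
  have hpKF : ¬ (p : ℤ) ∣ dK * dF := by
    intro h
    rcases (Nat.prime_iff_prime_int.mp (Fact.out : p.Prime)).dvd_mul.mp h with h | h
    · exact hpK h
    · exact hpF h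
  -- the three twists
  obtain ⟨W₁, i₁, i₁', hC₁, hX9₁, N₁, iN₁, f₁, hf₁, hn₁⟩ := SignedBalance.twist_data hX9 hsqK hpK hUK
  obtain ⟨W₂, i₂, i₂', hC₂, hX9₂, N₂, iN₂, f₂, hf₂, hn₂⟩ := SignedBalance.twist_data hX9 hsqF hpF hUF
  obtain ⟨W₃, i₃, i₃', hC₃, hX9₃, N₃, iN₃, f₃, hf₃, hn₃⟩ := SignedBalance.twist_data hX9 hsqKF hpKF hUKF
  haveI := i₁; haveI := i₁'; haveI := iN₁; haveI := i₂; haveI := i₂'; haveI := iN₂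
  haveI := i₃; haveI := i₃'; haveI := iN₃
  obtain ⟨D₁⟩ := W₁.nonempty_selmerDualData_holds κ γ hγ
  obtain ⟨D₂⟩ := W₂.nonempty_selmerDualData_holds κ γ hγ
  obtain ⟨D₃⟩ := W₃.nonempty_selmerDualData_holds κ γ hγ
  obtain ⟨-, g₁, k₁, hchar₁, hιg₁⟩ :=
    hBCSa W₁ p κ γ f₁ hX9₁.2.1 hX9₁.2.2.1 hX9₁.2.2.2.1 hX9₁.2.2.2.2.1 hκ hγ hγ' hf₁ D₁
  obtain ⟨-, g₂, k₂, hchar₂, hιg₂⟩ :=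
    hBCSa W₂ p κ γ f₂ hX9₂.2.1 hX9₂.2.2.1 hX9₂.2.2.2.1 hX9₂.2.2.2.2.1 hκ hγ hγ' hf₂ D₂
  obtain ⟨-, g₃, k₃, hchar₃, hιg₃⟩ :=
    hBCSa W₃ p κ γ f₃ hX9₃.2.1 hX9₃.2.2.1 hX9₃.2.2.2.1 hX9₃.2.2.2.2.1 hκ hγ hγ' hf₃ D₃
  have hk1 : 0 ≤ k₁ := SignedBalance.defect_nonneg_of_unit_coeff hn₁ hιg₁
  have hk2 : 0 ≤ k₂ := SignedBalance.defect_nonneg_of_unit_coeff hn₂ hιg₂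
  have hk3 : 0 ≤ k₃ := SignedBalance.defect_nonneg_of_unit_coeff hn₃ hιg₃
  have hsum : k + k₁ + k₂ + k₃ ≤ 0 :=
    hUp W p dK dF hX9 hadm W₁ W₂ W₃ hC₁ hC₂ hC₃ κ γ f f₁ f₂ f₃ hκ hγ hγ' hf hf₁ hf₂ hf₃ D D₁ D₂ D₃
      k k₁ k₂ k₃ ⟨g, hchar, hιg⟩ ⟨g₁, hchar₁, hιg₁⟩ ⟨g₂, hchar₂, hιg₂⟩ ⟨g₃, hchar₃, hιg₃⟩
  omega


/-- The route item, by its fully qualified name. -/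
theorem assemblyViaUpper_holds :
    Summit.BirchSwinnertonDyer.BirchSwinnertonDyer.Theses.SignedBalanceX9.AssemblyViaUpper :=
  signedBalanceX9_assemblyViaUpper

end SignedBalanceUpper

end Summit.BirchSwinnertonDyer.BirchSwinnertonDyer.Rank1Residual

end
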